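import Literature.Topology.FourManifolds.ManolescuPiccirillo2023Census
import Literature.Topology.FourManifolds.ZeroSurgeryHomotopyBallSliceHolds
import Literature.Topology.FourManifolds.HomotopyBallSliceProofs
import Literature.Topology.FourManifolds.Rasmussen
import Literature.Uncategorized.Crux
import HarnessLib

/-!
# The Manolescu–Piccirillo census criterion — discharged form

Citation header. C. Manolescu, L. Piccirillo, *From zero surgeries to candidates for exotic
definite 4-manifolds*, J. Lond. Math. Soc. (2) 108 (2023) 2001–2036 = arXiv:2102.04391v3,
proof of Thm 1.3 (0surg.tex:816), case `n = 0` (`W = S⁴`); J. Rasmussen, *Khovanov homology and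
the slice genus*, Invent. Math. 182 (2010), Thm 1.  What is reproduced: nothing new is asserted.
`ManolescuPiccirillo2023Census.exotic_of_flagged_pair` takes MP Lemma 3.3 (`W = S⁴`) and the
FGMW lemma as HYPOTHESES (`Knot.ManolescuPiccirillo2023_lemma33_sphere`,
`Knot.exists_exotic_of_isHomotopyBallSlice_not_isSmoothlySlice`); both are THEOREMS of the tree
(`Knot.ManolescuPiccirillo2023_lemma33_sphere_holds`, `ZeroSurgeryHomotopyBallSliceHolds`;
`Knot.exists_exotic_of_isHomotopyBallSlice_not_isSmoothlySlice_holds`, `HomotopyBallSliceProofs`),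
so the census criterion holds with Rasmussen's slice obstruction for the invariant used as its
ONLY named hypothesis.  The second half records, by name, that a flagged census pair whose
`s(K')` is the tree's honest Lee–Rasmussen invariant (`Knot.HasRasmussenInvariant`) is exactly a
witness of the registered open statement `Literature.Uncategorized.Crux` (route item
stmt-SmoothPoincare4-0366 `ZseCruxRasmussen`), via the bridge
`FramedLink.isSurgery_single_iff` between the two renderings of "`Y` is `0`-surgery on `K`".
Census rows (knots given by PD codes, computed `s`-values) live in the bundle
`papers/SmoothPoincare4/sp4-mp-census` and are NOT asserted here.
-/

open scoped Manifold ContDiff Topology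
open ContinuousMap

noncomputable section

namespace Literature.Topology.FourManifolds

namespace MPCensus

/-- `CommonZeroSurgery` is symmetric in the two knots. [cite: ManolescuPiccirillo2023, Thm 1.2] -/
theorem CommonZeroSurgery.symm {K K' : Knot} (h : CommonZeroSurgery K K') :
    CommonZeroSurgery K' K := by
  obtain ⟨Y, _, _, h1, h2⟩ := h
  exact ⟨Y, _, _, h2, h1⟩

/-- `CommonZeroSurgery K K'` in the `IsIntegralSurgery` rendering used by the route items of
`Summits/SmoothPoincare4/SmoothPoincare4/Theses/ZeroSurgeryExotic.lean` (bridge: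
`FramedLink.isSurgery_single_iff`). [cite: ManolescuPiccirillo2023, Thm 1.2] -/
theorem commonZeroSurgery_iff_isIntegralSurgery (K K' : Knot) :
    CommonZeroSurgery K K' ↔
      ∃ (Y : Type) (_ : TopologicalSpace Y) (_ : ChartedSpace (EuclideanSpace ℝ (Fin 3)) Y),
        IsIntegralSurgery (𝓡 3) Y K 0 ∧ IsIntegralSurgery (𝓡 3) Y K' 0 := by
  constructor
  · rintro ⟨Y, _, _, h1, h2⟩
    exact ⟨Y, _, _, (FramedLink.isSurgery_single_iff K 0).1 h1,
      (FramedLink.isSurgery_single_iff K' 0).1 h2⟩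
  · rintro ⟨Y, _, _, h1, h2⟩
    exact ⟨Y, _, _, (FramedLink.isSurgery_single_iff K 0).2 h1,
      (FramedLink.isSurgery_single_iff K' 0).2 h2⟩

/-- **The census criterion, discharged** (MP, proof of Thm 1.3, case `n = 0`): MP Lemma 3.3
(`W = S⁴`) and the FGMW lemma are theorems of the tree, so a pair `(K, K')` with a common
`0`-surgery, `s(K') ≠ 0` for an integer invariant `s` obeying Rasmussen's slice obstruction, and
`K` smoothly slice yields an exotic `S⁴`.  The only named hypothesis left is `SliceObstruction s`
(Rasmussen 2010 Thm 1 for `s` over `ℚ`; Mackaay–Turner–Vaz / Lipshitz–Sarkar for other fields).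
[cite: ManolescuPiccirillo2023, Thm 1.3 (proof), §1 p. 1] -/
theorem exotic_of_flagged_pair_holds
    {s : Knot → ℤ} (hRas : SliceObstruction s)
    {K K' : Knot} (h0 : CommonZeroSurgery K K') (hs : s K' ≠ 0) (hK : K.IsSmoothlySlice) :
    ∃ (M : Type) (_ : TopologicalSpace M) (_ : T2Space M) (_ : SecondCountableTopology M)
      (_ : ChartedSpace (EuclideanSpace ℝ (Fin 4)) M) (_ : IsManifold (𝓡 4) ∞ M) (_ : CompactSpace M),
      Nonempty (M ≃ₕ (Metric.sphere (0 : EuclideanSpace ℝ (Fin 5)) 1)) ∧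
        IsEmpty (M ≃ₘ⟮𝓡 4, 𝓡 4⟯ (Metric.sphere (0 : EuclideanSpace ℝ (Fin 5)) 1)) :=
  exotic_of_flagged_pair Knot.ManolescuPiccirillo2023_lemma33_sphere_holds
    Knot.exists_exotic_of_isHomotopyBallSlice_not_isSmoothlySlice_holds hRas h0 hs hK

/-- **A flagged pair with an honest Rasmussen invariant is a `Crux` witness**: a common
`0`-surgery, `K` smoothly slice and `K'.HasRasmussenInvariant s` with `s ≠ 0` (the tree's own
Lee–Rasmussen invariant of a Gauss diagram, `LeeRasmussen`) is literally an instance of the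
registered open statement `Literature.Uncategorized.Crux` (route item stmt-SmoothPoincare4-0366);
no slice obstruction is needed for this direction. [cite: ManolescuPiccirillo2023, §1 p. 1 and Remark 1.5] -/
theorem crux_of_flagged_pair {K K' : Knot} {s : ℤ} (h0 : CommonZeroSurgery K K')
    (hK : K.IsSmoothlySlice) (hs : K'.HasRasmussenInvariant s) (hs0 : s ≠ 0) :
    Literature.Uncategorized.Crux := by
  obtain ⟨Y, _, _, h1, h2⟩ := (commonZeroSurgery_iff_isIntegralSurgery K K').1 h0
  exact ⟨K, K', Y, _, _, s, h1, h2, hK, hs, hs0⟩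

/-- Conversely every `Crux` witness is a flagged pair in the census currency (common
`0`-surgery, `K` slice, honest `s(K') ≠ 0`). [cite: ManolescuPiccirillo2023, §1 p. 1] -/
theorem flagged_pair_of_crux (h : Literature.Uncategorized.Crux) :
    ∃ (K K' : Knot) (s : ℤ), CommonZeroSurgery K K' ∧ K.IsSmoothlySlice ∧
      K'.HasRasmussenInvariant s ∧ s ≠ 0 := by
  obtain ⟨K, K', Y, _, _, s, h1, h2, hK, hs, hs0⟩ := h
  exact ⟨K, K', s, (commonZeroSurgery_iff_isIntegralSurgery K K').2 ⟨Y, _, _, h1, h2⟩, hK, hs, hs0⟩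

/-- **The census criterion in the tree's Rasmussen currency**: given Rasmussen's Theorem 1 as the
named fact `eq_zero_of_isSmoothlySlice` (slice ⇒ `s = 0` for `Knot.HasRasmussenInvariant`), a
flagged pair with honest `s(K') ≠ 0` and `K` smoothly slice yields an exotic `S⁴` — through
`crux_of_flagged_pair`, MP Lemma 3.3 (proved) and the FGMW lemma (proved).
[cite: ManolescuPiccirillo2023, Thm 1.3 (proof), §1 p. 1] -/
theorem exotic_of_flagged_pair_rasmussen (hR : eq_zero_of_isSmoothlySlice)
    {K K' : Knot} {s : ℤ} (h0 : CommonZeroSurgery K K') (hK : K.IsSmoothlySlice)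
    (hs : K'.HasRasmussenInvariant s) (hs0 : s ≠ 0) :
    ∃ (M : Type) (_ : TopologicalSpace M) (_ : T2Space M) (_ : SecondCountableTopology M)
      (_ : ChartedSpace (EuclideanSpace ℝ (Fin 4)) M) (_ : IsManifold (𝓡 4) ∞ M) (_ : CompactSpace M),
      Nonempty (M ≃ₕ (Metric.sphere (0 : EuclideanSpace ℝ (Fin 5)) 1)) ∧
        IsEmpty (M ≃ₘ⟮𝓡 4, 𝓡 4⟯ (Metric.sphere (0 : EuclideanSpace ℝ (Fin 5)) 1)) := by
  obtain ⟨Y, _, _, h1, h2⟩ := h0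
  have hK' : ¬ K'.IsSmoothlySlice := fun h => hs0 (hR hs h)
  exact Knot.ManolescuPiccirillo2023_lemma33_sphere.exists_exotic
    Knot.ManolescuPiccirillo2023_lemma33_sphere_holds
    Knot.exists_exotic_of_isHomotopyBallSlice_not_isSmoothlySlice_holds
    ⟨K, K', Y, _, _, h1, h2, hK, hK'⟩

/- Axiom audit (scratch check 2026-08-21, `#print axioms exotic_of_flagged_pair_holds`):
`[propext, Classical.choice, Quot.sound]` — no `sorryAx`, no named-fact constants
(`SliceObstruction s` is a hypothesis, not an axiom). -/

end MPCensus

end Literature.Topology.FourManifolds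

end
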